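import Summits.Schanuel.Schanuel.Theorems.DiophantineDichotomyApproximationPropertyZeroDimDictionaryDegree
import HarnessLib

/-!
# The 0-dimensional dictionary, III: the value `|𝔭(ω̄)|` and the height of the point

Crux `stmt-Schanuel-6117` (`Summit.Schanuel.Schanuel.Theses.DiophantineDichotomy.ApproximationProperty`),
line `orbit-interpolation-determinant`, registered stub `stub_zeroDimDictionary : ZeroDimDictionary`
(proved in `DiophantineDichotomyApproximationPropertyZeroDimDictionary.lean`); sequel of
`…ZeroDimDictionaryDegree.lean`. With `K = ℚ(b̄')`, `g = c ∏_σ ℓ_{σ(b̄)}` the one-block form of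
the associated form of a rank-1 homogeneous prime `𝔭`, everything PROVED:

* `exp_mul_prod_projDist_le_iabs` (D) — `|𝔭(ω̄)| ≥ e^{−(n + log(m+1)) deg 𝔭} ∏_σ ‖ω̄ − σ(b̄)‖`,
  `n = m(m+1)/2`: `ϰ(F) = c ∏_σ ℓ_{σb̄}(S ω̄)`, `|ℓ_{σb̄}(Sω̄)| ≥ ‖ω̄ − σb̄‖ |ω̄| |σb̄|`, Gelfond's
  inequality for the product of the `deg 𝔭` linear factors in the `n` skew variables, and
  `|F| ≤ |c| (m+1)^{deg 𝔭} ∏ |σb̄|`;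
* `exists_int_model` — a primitive integer model `Z₁` of `F` with
  `log L(Z₁) ≤ h(𝔭) + deg 𝔭 · log(m+1)`;
* `logHeight_le` (C) — `h_K(b̄) ≤ h(𝔭) + deg 𝔭 · log(m+1)`: over the compositum `K'` of the
  conjugate fields, Gelfond–Mahler (`Roy2013.sum_mul_logHeight_le'`) for `Z₁ = a ∏_σ ℓ_{σ(b̄)}` and
  the field independence of `h/[K:ℚ]` (`NguyenRoy.logHeight_comp_div_finrank`);
* `stub_zeroDimDictionary_value` — the registered sub-goal of this file.

Sources: Nesterenko, LNM 1752 Ch. 3 §4 (Def. 4.2, 4.6, property 3 of `|I(ω̄)|`, Prop. 4.13);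
Bombieri–Gubler §1.6 (Lemmas 1.6.3, 1.6.11).
-/

noncomputable section

-- `Summit.Schanuel.Schanuel.…` is the mandated summit/sub-problem namespace (single-conjunct summit), hence:
set_option linter.dupNamespace false

namespace Summit.Schanuel.Schanuel.Cruxes.ApproximationProperty.OrbitInterpolationDeterminant

open Literature.NumberTheory.Transcendental.Nesterenko MvPolynomial
open scoped BigOperators

variable {m : ℕ}

/-! ## §3  The value `|𝔭(ω̄)|` against the product of the distances to the conjugates -/

section Value

variable {𝔭 : Ideal (Rx m)}

/-- `ϰ(F)` is the one-block form with `(S ω̄)_j` substituted for `x_j`. [cite: NesterenkoPhilippon2001,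
Ch. 3 Def. 4.6 (p. 39)] -/
theorem kappa_eq_aeval_oneBlock (ω : Fin (m + 1) → ℂ) (F : RU 1 m) :
    kappa ω F = aeval (fun j => lam ω (0 : Fin 1) j) (rename Prod.snd (map (algebraMap ℚ ℂ) F)) := by
  rw [kappa_eq_aeval_lam, aeval_rename, Function.comp_def, aeval_map_algebraMap]
  refine congrArg (fun f => aeval f F) (funext fun v => ?_)
  rw [Fin.fin_one_eq_zero v.1]

/-- **(D) `|𝔭(ω̄)| ≥ e^{−c deg 𝔭} ∏_σ ‖ω̄ − σ(b̄)‖`** with `c = m(m+1)/2 + log(m+1)`: write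
`ϰ(F) = c ∏_σ ℓ_{σb̄}(S ω̄)`; each factor has `|ℓ_{σb̄}(S ω̄)| ≥ ‖ω̄ − σb̄‖ |ω̄| |σb̄|`, Gelfond's
inequality bounds `∏_σ |ℓ_σ(Sω̄)| ≤ e^{n deg 𝔭} |∏_σ ℓ_σ(Sω̄)|` (`n = m(m+1)/2` skew variables), and
`|F| ≤ |c| (m+1)^{deg 𝔭} ∏_σ |σb̄|`. [cite: NesterenkoPhilippon2001, Ch. 3 §4, property 3 of
`|I(ω̄)|` / Prop. 4.13 (p. 41); BombieriGubler2006, Lemma 1.6.11] -/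
theorem exp_mul_prod_projDist_le_iabs (h𝔭 : 𝔭.IsPrime)
    (hhom : letI := MvPolynomial.gradedAlgebra (σ := Fin (m + 1)) (R := ℚ);
      𝔭.IsHomogeneous (homogeneousSubmodule (Fin (m + 1)) ℚ)) (hunm : IsUnmixedOfRank 𝔭 1)
    {b' : Fin (m + 1) → ℂ} (hb' : b' ∈ projZeros 𝔭) {j : Fin (m + 1)} (hj : b' j = 1)
    [NumberField ↥(IntermediateField.adjoin ℚ (Set.range b'))]
    {b : Fin (m + 1) → ↥(IntermediateField.adjoin ℚ (Set.range b'))} (hb : ∀ k, (b k : ℂ) = b' k)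
    {ω : Fin (m + 1) → ℂ} (hω : ω ≠ 0) :
    Real.exp (-((Fintype.card (Fin 1 × SkewIdx m) + Real.log (m + 1)) * ideg 𝔭 1)) *
        ∏ σ : ↥(IntermediateField.adjoin ℚ (Set.range b')) →+* ℂ, projDist ω (fun k => σ (b k)) ≤
      iabs 𝔭 1 ω := by
  classical
  obtain ⟨c, hc, hgeq⟩ := exists_split_embeddings h𝔭 hhom hunm hb' hj hb
  obtain ⟨hg0, hgnorm, -, hgdeg⟩ := oneBlock_facts h𝔭 hhom hunm
  set g := rename Prod.snd (map (algebraMap ℚ ℂ) (chowForm 𝔭 1)) with hgdef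
  set N := ideg 𝔭 1 with hNdef
  set E := ↥(IntermediateField.adjoin ℚ (Set.range b')) →+* ℂ
  set β : E → Fin (m + 1) → ℂ := fun σ k => σ (b k) with hβdef
  have hcardE : Fintype.card E = N := by
    rw [NumberField.Embeddings.card, finrank_eq_ideg h𝔭 hhom hunm hb' hj hb]
  set κ : MvPolynomial (Fin (m + 1)) ℂ →ₐ[ℂ] RS 1 m := aeval (fun j => lam ω (0 : Fin 1) j)
    with hκdef
  set L : E → RS 1 m := fun σ => κ (∑ k, C (β σ k) * X k) with hLdef
  have hκg : κ g = C c * ∏ σ, L σ := by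
    rw [hgeq, map_mul, map_prod, hκdef, aeval_C, MvPolynomial.algebraMap_eq]
  have hβ0 : ∀ σ, β σ ≠ 0 := fun σ => (map_mem_projZeros hb' hj hb σ).1
  have hωpos : 0 < ‖ω‖ := norm_pos_iff.mpr hω
  have hLge : ∀ σ, projDist ω (β σ) * (‖ω‖ * ‖β σ‖) ≤ maxNorm (L σ) := fun σ =>
    projDist_mul_le_maxNorm_aeval_lam_linC ω (β σ)
  -- `|𝔭(ω̄)| = |κ g| / (|g| |ω̄|^N)`
  have hiabs : iabs 𝔭 1 ω = maxNorm (κ g) / (maxNorm g * ‖ω‖ ^ N) := by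
    rw [iabs, kappa_eq_aeval_oneBlock, one_mul, hgnorm]
  have hPd0 : 0 ≤ ∏ σ, projDist ω (β σ) := Finset.prod_nonneg fun σ _ => projDist_nonneg _ _
  by_cases h0 : κ g = 0
  · -- some factor vanishes, hence some distance is `0`
    rw [hκg, mul_eq_zero, C_eq_zero] at h0
    obtain ⟨σ, -, hσ⟩ := Finset.prod_eq_zero_iff.mp (h0.resolve_left hc)
    have hd : projDist ω (β σ) = 0 := by
      refine le_antisymm ?_ (projDist_nonneg _ _)
      have h1 := hLge σ
      rw [show L σ = 0 from hσ, maxNorm_zero] at h1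
      have hpos : 0 < ‖ω‖ * ‖β σ‖ := mul_pos hωpos (norm_pos_iff.mpr (hβ0 σ))
      nlinarith [projDist_nonneg ω (β σ)]
    rw [Finset.prod_eq_zero (Finset.mem_univ σ) hd, mul_zero]
    exact iabs_nonneg _ _ _
  · have hL0 : ∀ σ, L σ ≠ 0 := by
      intro σ hσ
      apply h0
      rw [hκg]
      exact mul_eq_zero_of_right _ (Finset.prod_eq_zero (Finset.mem_univ σ) hσ)
    -- Gelfond: `∏ |L σ| ≤ e^{nN} |∏ L σ|`
    have hgelf := prod_maxNorm_le_exp_mul_maxNorm_prod Finset.univ L (fun σ _ => hL0 σ)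
    have hdegsum : (∑ v : Fin 1 × SkewIdx m, (∑ σ, degreeOf v (L σ) : ℝ)) ≤
        Fintype.card (Fin 1 × SkewIdx m) * N := by
      calc (∑ v : Fin 1 × SkewIdx m, (∑ σ, degreeOf v (L σ) : ℝ))
          ≤ ∑ _v : Fin 1 × SkewIdx m, (N : ℝ) := Finset.sum_le_sum fun v _ => by
            calc (∑ σ, degreeOf v (L σ) : ℝ) ≤ ∑ _σ : E, (1 : ℝ) :=
                  Finset.sum_le_sum fun σ _ => by
                    exact_mod_cast degreeOf_aeval_lam_linC_le ω (β σ) v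
              _ = N := by simp [hcardE]
        _ = Fintype.card (Fin 1 × SkewIdx m) * N := by
            rw [Finset.sum_const, Finset.card_univ, nsmul_eq_mul]
    have hgelf' : ∏ σ, maxNorm (L σ) ≤
        Real.exp (Fintype.card (Fin 1 × SkewIdx m) * N) * maxNorm (∏ σ, L σ) :=
      hgelf.trans (mul_le_mul_of_nonneg_right (Real.exp_le_exp.mpr hdegsum) (maxNorm_nonneg _))
    -- lower bound `∏ (d_σ |ω| |β σ|) ≤ ∏ |L σ|`
    have hlow : ∏ σ, (projDist ω (β σ) * ‖ω‖ * ‖β σ‖) ≤ ∏ σ, maxNorm (L σ) := by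
      refine Finset.prod_le_prod (fun σ _ =>
        mul_nonneg (mul_nonneg (projDist_nonneg _ _) (norm_nonneg _)) (norm_nonneg _)) fun σ _ => ?_
      rw [mul_assoc]; exact hLge σ
    have hprodβ : ∏ σ, (projDist ω (β σ) * ‖ω‖ * ‖β σ‖) =
        (∏ σ, projDist ω (β σ)) * ‖ω‖ ^ N * ∏ σ, ‖β σ‖ := by
      rw [Finset.prod_mul_distrib, Finset.prod_mul_distrib, Finset.prod_const, Finset.card_univ,
        hcardE]
    -- upper bound `|g| ≤ |c| (m+1)^N ∏ |β σ|`
    have hup : maxNorm g ≤ ‖c‖ * ((m + 1 : ℝ) ^ N * ∏ σ, ‖β σ‖) := by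
      calc maxNorm g ≤ l1Norm g := maxNorm_le_l1Norm g
        _ = l1Norm (C c * ∏ σ, (∑ k, C (β σ k) * X k : MvPolynomial (Fin (m + 1)) ℂ)) :=
            congrArg l1Norm hgeq
        _ ≤ l1Norm (C c : MvPolynomial (Fin (m + 1)) ℂ) *
              l1Norm (∏ σ, (∑ k, C (β σ k) * X k : MvPolynomial (Fin (m + 1)) ℂ)) :=
            l1Norm_mul_le _ _
        _ ≤ ‖c‖ * ∏ σ, ((m + 1 : ℝ) * ‖β σ‖) := by
            rw [l1Norm_C]
            refine mul_le_mul_of_nonneg_left ?_ (norm_nonneg _)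
            refine (l1Norm_prod_le _ _).trans ?_
            exact Finset.prod_le_prod (fun σ _ => l1Norm_nonneg _) fun σ _ => l1Norm_linC_le (β σ)
        _ = ‖c‖ * ((m + 1 : ℝ) ^ N * ∏ σ, ‖β σ‖) := by
            rw [Finset.prod_mul_distrib, Finset.prod_const, Finset.card_univ, hcardE]
    have hκnorm : maxNorm (κ g) = ‖c‖ * maxNorm (∏ σ, L σ) := by
      rw [hκg, maxNorm_C_mul]
    -- assemble
    have hP0 : 0 ≤ ∏ σ, ‖β σ‖ := Finset.prod_nonneg fun σ _ => norm_nonneg _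
    have hkey : (∏ σ, projDist ω (β σ)) * ‖ω‖ ^ N * ∏ σ, ‖β σ‖ ≤
        Real.exp (Fintype.card (Fin 1 × SkewIdx m) * N) * maxNorm (∏ σ, L σ) := by
      rw [← hprodβ]; exact hlow.trans hgelf'
    have hmain : (∏ σ, projDist ω (β σ)) * ‖ω‖ ^ N * maxNorm g ≤
        Real.exp (Fintype.card (Fin 1 × SkewIdx m) * N) * (m + 1 : ℝ) ^ N * maxNorm (κ g) := by
      calc (∏ σ, projDist ω (β σ)) * ‖ω‖ ^ N * maxNorm g
          ≤ (∏ σ, projDist ω (β σ)) * ‖ω‖ ^ N * (‖c‖ * ((m + 1 : ℝ) ^ N * ∏ σ, ‖β σ‖)) :=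
            mul_le_mul_of_nonneg_left hup (mul_nonneg hPd0 (pow_nonneg (norm_nonneg _) N))
        _ = ‖c‖ * (m + 1 : ℝ) ^ N * ((∏ σ, projDist ω (β σ)) * ‖ω‖ ^ N * ∏ σ, ‖β σ‖) := by
            ring
        _ ≤ ‖c‖ * (m + 1 : ℝ) ^ N *
              (Real.exp (Fintype.card (Fin 1 × SkewIdx m) * N) * maxNorm (∏ σ, L σ)) :=
            mul_le_mul_of_nonneg_left hkey (by positivity)
        _ = Real.exp (Fintype.card (Fin 1 × SkewIdx m) * N) * (m + 1 : ℝ) ^ N * maxNorm (κ g) := by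
            rw [hκnorm]; ring
    -- divide
    have hgpos : 0 < maxNorm g := maxNorm_pos hg0
    have hden : 0 < maxNorm g * ‖ω‖ ^ N := mul_pos hgpos (pow_pos hωpos N)
    have hexp : Real.exp ((Fintype.card (Fin 1 × SkewIdx m) + Real.log (m + 1)) * N) =
        Real.exp (Fintype.card (Fin 1 × SkewIdx m) * N) * (m + 1 : ℝ) ^ N := by
      rw [add_mul, Real.exp_add]
      congr 1
      rw [mul_comm, Real.exp_nat_mul, Real.exp_log (by positivity)]
    have hApos : 0 < Real.exp (Fintype.card (Fin 1 × SkewIdx m) * N) * (m + 1 : ℝ) ^ N := by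
      positivity
    rw [hiabs, Real.exp_neg, le_div_iff₀ hden, hexp, mul_assoc, inv_mul_le_iff₀ hApos]
    calc (∏ σ, projDist ω (β σ)) * (maxNorm g * ‖ω‖ ^ N)
        = (∏ σ, projDist ω (β σ)) * ‖ω‖ ^ N * maxNorm g := by ring
      _ ≤ _ := hmain

end Value

/-! ## §4  The height of the point against the height of the associated form -/

section HeightBound

variable {𝔭 : Ideal (Rx m)}

/-- Descent of the constant of a factorisation: if `f, P ∈ K'[x]`, `P ≠ 0`, and `f = a P` after
extension of scalars to `ℂ`, then `f = a' P` already over `K'`. [folklore] -/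
theorem exists_eq_C_mul_of_map_eq {σ : Type*} {K' : IntermediateField ℚ ℂ}
    (f P : MvPolynomial σ K') (hP : P ≠ 0) {a : ℂ}
    (h : map (algebraMap K' ℂ) f = C a * map (algebraMap K' ℂ) P) :
    ∃ a' : K', f = C a' * P := by
  classical
  obtain ⟨e₀, he₀⟩ := support_nonempty.mpr hP
  have hPe : coeff e₀ P ≠ 0 := mem_support_iff.mp he₀
  have hinj : Function.Injective (algebraMap K' ℂ) := (algebraMap K' ℂ).injective
  have ha : a = algebraMap K' ℂ (coeff e₀ f / coeff e₀ P) := by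
    have h1 := congrArg (coeff e₀) h
    rw [coeff_map, coeff_C_mul, coeff_map] at h1
    rw [map_div₀, eq_div_iff ((map_ne_zero_iff _ hinj).mpr hPe)]
    exact h1.symm
  refine ⟨coeff e₀ f / coeff e₀ P, map_injective _ hinj ?_⟩
  rw [h, map_mul, map_C, ← ha]

/-- **A primitive integer model of the associated form and the length of its coefficient vector**:
`F(x̲) = q Z₁(x̲)` over `ℂ` with `q ∈ ℚˣ`, `Z₁ ∈ ℤ[x₀, …, x_m] ∖ 0` and
`log L(Z₁) ≤ h(𝔭) + deg 𝔭 · log(m+1)` (`L = ∑ |coefficients|`, at most `(m+1)^{deg 𝔭}` of them, each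
at most `|Z₁| = e^{h(F)}` as `Z₁` is primitive). [cite: NesterenkoPhilippon2001, Ch. 3 §4, remark
after Def. 4.2 and after Prop. 4.4 (p. 38)] -/
theorem exists_int_model (h𝔭 : 𝔭.IsPrime)
    (hhom : letI := MvPolynomial.gradedAlgebra (σ := Fin (m + 1)) (R := ℚ);
      𝔭.IsHomogeneous (homogeneousSubmodule (Fin (m + 1)) ℚ)) (hunm : IsUnmixedOfRank 𝔭 1) :
    ∃ (q : ℚ) (Z₁ : MvPolynomial (Fin (m + 1)) ℤ), q ≠ 0 ∧ Z₁ ≠ 0 ∧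
      rename Prod.snd (map (algebraMap ℚ ℂ) (chowForm 𝔭 1)) =
        C (q : ℂ) * map (Int.castRingHom ℂ) Z₁ ∧
      Real.log (∑ e ∈ Z₁.support, |((coeff e Z₁ : ℤ) : ℝ)|) ≤
        iheight 𝔭 1 + Real.log (m + 1) * ideg 𝔭 1 := by
  classical
  obtain ⟨-, hF0, -, -, -, -⟩ := chowForm_facts h𝔭 hhom hunm
  obtain ⟨q, hq, Z, hFZ, hsupp, hgcd⟩ := exists_eq_C_mul_map_primitive (chowForm 𝔭 1) hF0
  have hZ0 : Z ≠ 0 := ne_zero_of_gcd_coeff_eq_one hgcd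
  set Z₁ : MvPolynomial (Fin (m + 1)) ℤ := rename Prod.snd Z with hZ₁
  have hZ₁0 : Z₁ ≠ 0 := (map_ne_zero_iff _ (rename_injective _ snd_injective_fin_one)).mpr hZ0
  refine ⟨q, Z₁, hq, hZ₁0, ?_, ?_⟩
  · rw [hFZ, map_mul, map_C, map_map, RingHom.ext_int ((algebraMap ℚ ℂ).comp (Int.castRingHom ℚ))
      (Int.castRingHom ℂ), map_mul, rename_C, ← map_rename]
    rfl
  · -- `L(Z₁) ≤ #supp · |Z₁|`, `#supp ≤ (m+1)^D`, `log |Z₁| ≤ h(F)`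
    set M := maxNorm (map (Int.castRingHom ℚ) Z) with hM
    have hMZ₁ : maxNorm (map (Int.castRingHom ℚ) Z₁) = M := by
      rw [hZ₁, map_rename, maxNorm_rename_of_injective snd_injective_fin_one]
    have hMpos : 0 < M :=
      maxNorm_pos ((map_ne_zero_iff _ (map_injective _ (RingHom.injective_int _))).mpr hZ0)
    have hcoeff : ∀ e ∈ Z₁.support, |((coeff e Z₁ : ℤ) : ℝ)| ≤ M := by
      intro e _
      have h1 := norm_coeff_le_maxNorm (map (Int.castRingHom ℚ) Z₁) e
      rw [hMZ₁, coeff_map, eq_intCast] at h1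
      have h2 : ‖((coeff e Z₁ : ℤ) : ℚ)‖ = |((coeff e Z₁ : ℤ) : ℝ)| := by
        rw [← Rat.norm_cast_real, Rat.cast_intCast, Real.norm_eq_abs]
      rwa [h2] at h1
    have hcard : (Z₁.support.card : ℝ) ≤ (m + 1 : ℝ) ^ ideg 𝔭 1 := by
      have h1 : Z₁.support.card = (chowForm 𝔭 1).support.card := by
        rw [hZ₁, support_rename_of_injective snd_injective_fin_one,
          Finset.card_image_of_injective _ (Finsupp.mapDomain_injective snd_injective_fin_one), hsupp]
      have h2 := card_support_chowForm_le_pow 𝔭 Nat.one_pos (r := 1)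
      rw [one_mul] at h2
      rw [h1]
      exact_mod_cast h2
    have hL : ∑ e ∈ Z₁.support, |((coeff e Z₁ : ℤ) : ℝ)| ≤ (m + 1 : ℝ) ^ ideg 𝔭 1 * M := by
      calc ∑ e ∈ Z₁.support, |((coeff e Z₁ : ℤ) : ℝ)| ≤ ∑ _e ∈ Z₁.support, M :=
            Finset.sum_le_sum hcoeff
        _ = Z₁.support.card * M := by rw [Finset.sum_const, nsmul_eq_mul]
        _ ≤ (m + 1 : ℝ) ^ ideg 𝔭 1 * M := mul_le_mul_of_nonneg_right hcard hMpos.le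
    have hLpos : 0 < ∑ e ∈ Z₁.support, |((coeff e Z₁ : ℤ) : ℝ)| :=
      lt_of_lt_of_le one_pos (Literature.NumberTheory.Transcendental.Roy2013.one_le_sum_abs_coeff hZ₁0)
    have hheight : Real.log M ≤ iheight 𝔭 1 := by
      rw [iheight, hFZ, height_C_mul hq]
      exact log_maxNorm_map_le_height Z hgcd
    calc Real.log (∑ e ∈ Z₁.support, |((coeff e Z₁ : ℤ) : ℝ)|)
        ≤ Real.log ((m + 1 : ℝ) ^ ideg 𝔭 1 * M) := Real.log_le_log hLpos hL
      _ = Real.log (m + 1) * ideg 𝔭 1 + Real.log M := by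
          rw [Real.log_mul (by positivity) hMpos.ne', Real.log_pow]; ring
      _ ≤ iheight 𝔭 1 + Real.log (m + 1) * ideg 𝔭 1 := by linarith

/-- **(C) `h_K(b̄) ≤ h(𝔭) + deg 𝔭 · log(m+1)`.** Over the compositum `K' ⊆ ℂ` of the conjugate
fields `σ(K)`, the primitive integer model `Z₁` of the associated form factors as
`a ∏_σ ℓ_{σ(b̄)}`; the Gelfond–Mahler inequality (`Roy2013.sum_mul_logHeight_le'`: Gauss's lemma at
the finite places, the product lemma at the archimedean ones) gives
`∑_σ h_{K'}(σ b̄) ≤ [K':ℚ] log L(Z₁)`, and `h_{K'}(σ b̄)/[K':ℚ] = h_K(b̄)/[K:ℚ]` for each of the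
`[K:ℚ]` embeddings (`NguyenRoy.logHeight_comp_div_finrank`). [cite: NesterenkoPhilippon2001, Ch. 3
§4 (p. 38); BombieriGubler2006, §1.6, Lemma 1.6.3 and 1.6.11] -/
theorem logHeight_le (h𝔭 : 𝔭.IsPrime)
    (hhom : letI := MvPolynomial.gradedAlgebra (σ := Fin (m + 1)) (R := ℚ);
      𝔭.IsHomogeneous (homogeneousSubmodule (Fin (m + 1)) ℚ)) (hunm : IsUnmixedOfRank 𝔭 1)
    {b' : Fin (m + 1) → ℂ} (hb' : b' ∈ projZeros 𝔭) {j : Fin (m + 1)} (hj : b' j = 1)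
    [NumberField ↥(IntermediateField.adjoin ℚ (Set.range b'))]
    {b : Fin (m + 1) → ↥(IntermediateField.adjoin ℚ (Set.range b'))} (hb : ∀ k, (b k : ℂ) = b' k) :
    Height.logHeight b ≤ iheight 𝔭 1 + Real.log (m + 1) * ideg 𝔭 1 := by
  classical
  obtain ⟨q, Z₁, hq, hZ₁0, hgZ, hL⟩ := exists_int_model h𝔭 hhom hunm
  obtain ⟨c, hc, hgeq⟩ := exists_split_embeddings h𝔭 hhom hunm hb' hj hb
  have hbj : b j = 1 := Subtype.ext (by rw [hb, hj]; rfl)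
  -- the compositum `K'` of the conjugate fields
  let K' : IntermediateField ℚ ℂ :=
    ⨆ σ : ↥(IntermediateField.adjoin ℚ (Set.range b')) →+* ℂ, (σ.toRatAlgHom).fieldRange
  haveI : ∀ σ : ↥(IntermediateField.adjoin ℚ (Set.range b')) →+* ℂ,
      FiniteDimensional ℚ ↥((σ.toRatAlgHom).fieldRange) := fun σ => by
    have h : FiniteDimensional ℚ (Subalgebra.toSubmodule (σ.toRatAlgHom).range) :=
      (σ.toRatAlgHom).toLinearMap.finiteDimensional_range
    rw [← AlgHom.fieldRange_toSubalgebra] at h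
    exact h
  haveI : FiniteDimensional ℚ ↥K' := IntermediateField.finiteDimensional_iSup_of_finite
  haveI : NumberField ↥K' :=
    Literature.NumberTheory.Transcendental.NguyenRoy.NFPres.numberField_of_intermediateField K'
  have hσK' : ∀ (σ : ↥(IntermediateField.adjoin ℚ (Set.range b')) →+* ℂ)
      (x : ↥(IntermediateField.adjoin ℚ (Set.range b'))), σ x ∈ K' := fun σ x =>
    (le_iSup (fun σ : ↥(IntermediateField.adjoin ℚ (Set.range b')) →+* ℂ =>
      (σ.toRatAlgHom).fieldRange) σ) ((AlgHom.mem_fieldRange).mpr ⟨x, rfl⟩)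
  -- the conjugate points with coordinates in `K'`
  let f : (↥(IntermediateField.adjoin ℚ (Set.range b')) →+* ℂ) →
      ↥(IntermediateField.adjoin ℚ (Set.range b')) →+* ↥K' := fun σ => σ.codRestrict K' (hσK' σ)
  let cv : (↥(IntermediateField.adjoin ℚ (Set.range b')) →+* ℂ) → Fin (m + 1) → ↥K' :=
    fun σ k => f σ (b k)
  have hcv_coe : ∀ σ k, ((cv σ k : ↥K') : ℂ) = σ (b k) := fun σ k => rfl
  have hcv0 : ∀ σ, cv σ ≠ 0 := by
    intro σ h
    have h2 : ((cv σ j : ↥K') : ℂ) = 0 := by rw [congrFun h j]; rfl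
    rw [hcv_coe, hbj, map_one] at h2
    exact one_ne_zero h2
  -- the factorisation over `K'`
  set P : MvPolynomial (Fin (m + 1)) ↥K' := ∏ σ, (∑ k, C (cv σ k) * X k) with hP
  have hmapP : map (algebraMap ↥K' ℂ) P =
      ∏ σ : ↥(IntermediateField.adjoin ℚ (Set.range b')) →+* ℂ, (∑ k, C (σ (b k)) * X k) := by
    rw [hP, map_prod]
    refine Finset.prod_congr rfl fun σ _ => ?_
    rw [map_sum]
    refine Finset.sum_congr rfl fun k _ => ?_
    rw [map_mul, map_C, map_X]
    rfl
  have hP0 : P ≠ 0 := by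
    intro h0
    have h1 := congrArg (map (algebraMap ↥K' ℂ)) h0
    rw [hmapP, map_zero] at h1
    rw [h1, mul_zero] at hgeq
    exact (oneBlock_facts h𝔭 hhom hunm).1 hgeq
  have hmapZ : map (algebraMap ↥K' ℂ) (map (Int.castRingHom ↥K') Z₁) =
      C ((q : ℂ)⁻¹ * c) * map (algebraMap ↥K' ℂ) P := by
    rw [map_map, RingHom.ext_int ((algebraMap ↥K' ℂ).comp (Int.castRingHom ↥K')) (Int.castRingHom ℂ),
      hmapP, map_mul C, mul_assoc, ← hgeq, hgZ, ← mul_assoc, ← map_mul C,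
      inv_mul_cancel₀ (by exact_mod_cast hq), C_1, one_mul]
  obtain ⟨a', ha'⟩ := exists_eq_C_mul_of_map_eq _ _ hP0 hmapZ
  have hfac : map (Int.castRingHom ↥K') Z₁ = C a' * ∏ σ, (∑ k, C (cv σ k) * X k) ^
      (fun _ : ↥(IntermediateField.adjoin ℚ (Set.range b')) →+* ℂ => 1) σ := by
    rw [ha', hP]
    simp only [pow_one]
  -- Gelfond–Mahler
  have hGM := Literature.NumberTheory.Transcendental.Roy2013.sum_mul_logHeight_le' hZ₁0 hcv0 hfac
  simp only [Nat.cast_one, one_mul] at hGM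
  -- each conjugate has `h_{K'}(σ b̄) = [K':ℚ]/[K:ℚ] · h_K(b̄)`
  have hK'pos : (0 : ℝ) < Module.finrank ℚ ↥K' := by exact_mod_cast Module.finrank_pos
  have hKpos : (0 : ℝ) < Module.finrank ℚ ↥(IntermediateField.adjoin ℚ (Set.range b')) := by
    exact_mod_cast Module.finrank_pos
  have hσ : ∀ σ, Height.logHeight (cv σ) = Module.finrank ℚ ↥K' *
      (Height.logHeight b / Module.finrank ℚ ↥(IntermediateField.adjoin ℚ (Set.range b'))) := by
    intro σ
    have h : Height.logHeight (cv σ) / Module.finrank ℚ ↥K' =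
        Height.logHeight b / Module.finrank ℚ ↥(IntermediateField.adjoin ℚ (Set.range b')) :=
      Literature.NumberTheory.Transcendental.NguyenRoy.logHeight_comp_div_finrank (f σ) b
    rw [← h, mul_div_cancel₀ _ hK'pos.ne']
  have hsum : ∑ σ, Height.logHeight (cv σ) = Module.finrank ℚ ↥K' * Height.logHeight b := by
    rw [Finset.sum_congr rfl fun σ _ => hσ σ, Finset.sum_const, Finset.card_univ,
      NumberField.Embeddings.card, nsmul_eq_mul]
    field_simp
  rw [hsum] at hGM
  have h1 : Height.logHeight b ≤ Real.log (∑ e ∈ Z₁.support, |((coeff e Z₁ : ℤ) : ℝ)|) :=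
    le_of_mul_le_mul_left hGM hK'pos
  exact h1.trans hL

end HeightBound

/-! ### The registered sub-goal of this helper file -/

/-- **Registered sub-goal `stub_zeroDimDictionary_value`** (crux `stmt-Schanuel-6117`, line
`orbit-interpolation-determinant`; the part of stub `stub_zeroDimDictionary` carried by this file):
the primitive integer model of the associated form of a rank-1 homogeneous prime and the bound on
the length of its coefficient vector. [cite: NesterenkoPhilippon2001, Ch. 3 §4 (p. 38)] -/
theorem stub_zeroDimDictionary_value : ∀ (m : ℕ) (𝔭 : Ideal (Rx m)), 𝔭.IsPrime → (letI := MvPolynomial.gradedAlgebra (σ := Fin (m + 1)) (R := ℚ); 𝔭.IsHomogeneous (homogeneousSubmodule (Fin (m + 1)) ℚ)) → IsUnmixedOfRank 𝔭 1 → ∃ (q : ℚ) (Z₁ : MvPolynomial (Fin (m + 1)) ℤ), q ≠ 0 ∧ Z₁ ≠ 0 ∧ rename Prod.snd (map (algebraMap ℚ ℂ) (chowForm 𝔭 1)) = C (q : ℂ) * map (Int.castRingHom ℂ) Z₁ ∧ Real.log (∑ e ∈ Z₁.support, |((coeff e Z₁ : ℤ) : ℝ)|) ≤ iheight 𝔭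 1 + Real.log (m + 1) * ideg 𝔭 1 :=
  fun _ _ h𝔭 hhom hunm => exists_int_model h𝔭 hhom hunm

end Summit.Schanuel.Schanuel.Cruxes.ApproximationProperty.OrbitInterpolationDeterminant

end
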